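import Mathlib

/-!
# The integer parabola lift: strong representative systems of size `p^{37/30}` in `AG(2,p)`
(wall-breaker axis `parabola lifts over finite fields`, stub `stub_tangencySets` of the crux
`LevelOneGL2Designs`, stmt-MatrixMultiplication-14080)

Companion to `LevelGradedCohnUmansLevelOneGL2DesignsTangencyParabolaLift.lean` (the `ZMod p` pencil, which reduces the
stub to Paley cocliques).  Here the parabola parameters are lifted from the INTEGERS: points
`(t, t² − a − 1)` with `0 ≤ t < L`, `a ∈ A ⊆ [0, N)`, `L² + N ≤ p`, tangent lines `2t·x − y = t² + a + 1 ∈ [1, p)`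
(so no tangent passes through the origin).  The incidence identity of the lift reads `(t − t')² ≡ a − a' (mod p)`,
and the size constraints turn the congruence into an equality of integers; so if `A` has no two elements
differing by a perfect square (a Furstenberg–Sárközy set) the `L·|A|` flags form a strong representative system
(Hunter–Pohoata–Verstraëte–Zhang 2026, arXiv:2601.19879, Prop. 2.3, "Ruzsa lift").  Ruzsa's digit construction in a
squarefree base `m` with a square-difference-free residue set `R` gives such `A ⊆ [0, m^{2k})` of size `(|R|·m)^k`;
with `m = 205`, `|R| = 12` (Lewko) this is `N^{0.7334}`, whence SRS of size `≥ c·p^{37/30} = c·p^{1.2333…}` for EVERY prime `p`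
(HPVZ Thm 1.2: `IM(2,p) ≫ p^{1.2334}`), in the exact flag format of `stub_tangencySets` — whose exponent `3/2` this
sub-axis can never reach (Sárközy: square-difference-free sets have density `o(1)`).

Elementary and fully proved; no definitions.
-/

set_option linter.dupNamespace false

noncomputable section

open Finset Matrix

namespace Summit.MatrixMultiplication.MatrixMultiplication.Theorems.LevelOneGL2Designs.ParabolaLift

section Lift

variable {p : ℕ} [Fact p.Prime]

/-- **Integer parabola lift (HPVZ 2026, Prop. 2.3).**  Let `L² + N ≤ p` and let `A ⊆ [0, N)` be a set of naturals
no two of which differ by a perfect square.  Then the flags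
`(t, a) ↦ ( (t, t² − a − 1), line {v : v ⬝ᵥ y = 1} with y = (t² + a + 1)⁻¹ • (2t, −1) )`, `t < L`, `a ∈ A`,
form a strong representative system of `AG(2,p)` with exactly `L·|A|` flags: the point of `(t, a)` lies on the line
of `(t', a')` iff `(t − t')² ≡ a − a' (mod p)`, and `|a − a' − (t − t')²| < N + L² ≤ p` forces equality in `ℤ`.
[cite: HunterPohoataVerstraeteZhang2026, Prop. 2.3] -/
theorem srs_of_sqDiffFree (L N : ℕ) (hLN : L ^ 2 + N ≤ p) (A : Finset ℕ) (hAN : ∀ a ∈ A, a < N)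
    (hA : ∀ a ∈ A, ∀ b ∈ A, ∀ m : ℕ, a = b + m ^ 2 → a = b) :
    ∃ F : Finset ((Fin 2 → ZMod p) × (Fin 2 → ZMod p)),
      F.card = L * A.card ∧ ∀ f ∈ F, ∀ f' ∈ F, (dotProduct f.1 f'.2 = 1 ↔ f = f') := by
  classical
  let flag : ℕ × ℕ → (Fin 2 → ZMod p) × (Fin 2 → ZMod p) := fun ta =>
    (![(ta.1 : ZMod p), (ta.1 : ZMod p) ^ 2 - ta.2 - 1],
      ((ta.1 : ZMod p) ^ 2 + ta.2 + 1)⁻¹ • ![2 * (ta.1 : ZMod p), -1])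
  have hNp : N ≤ p := le_trans (Nat.le_add_left N (L ^ 2)) hLN
  -- the normalising factor never vanishes
  have hne : ∀ t a : ℕ, t < L → a < N → ((t : ZMod p) ^ 2 + a + 1 : ZMod p) ≠ 0 := by
    intro t a ht ha h
    have ht2 : t ^ 2 < L ^ 2 := Nat.pow_lt_pow_left ht two_ne_zero
    have hlt : t ^ 2 + a + 1 < p := by omega
    have hcast : ((t ^ 2 + a + 1 : ℕ) : ZMod p) = 0 := by push_cast; exact h
    rw [ZMod.natCast_eq_zero_iff] at hcast
    exact absurd (Nat.le_of_dvd (by omega) hcast) (by omega)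
  -- the key incidence identity, decided over ℤ
  have key : ∀ t a t' a' : ℕ, t < L → a ∈ A → t' < L → a' ∈ A →
      ((flag (t, a)).1 ⬝ᵥ (flag (t', a')).2 = 1 ↔ t = t' ∧ a = a') := by
    intro t a t' a' ht ha ht' ha'
    have haN := hAN a ha
    have haN' := hAN a' ha'
    have hdot : (flag (t, a)).1 ⬝ᵥ (flag (t', a')).2
        = ((t' : ZMod p) ^ 2 + a' + 1)⁻¹ * (2 * t * t' - (t ^ 2 - a - 1)) := by
      simp only [flag, dotProduct_smul, vec2_dotProduct', smul_eq_mul]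
      ring
    rw [hdot, inv_mul_eq_one₀ (hne t' a' ht' haN')]
    constructor
    · intro h
      -- `D = a - a' - (t' - t)²` vanishes mod `p` and is small, hence zero
      set D : ℤ := (a : ℤ) - a' - ((t' : ℤ) - t) ^ 2 with hD
      have hDp : (p : ℤ) ∣ D := by
        rw [← ZMod.intCast_zmod_eq_zero_iff_dvd]
        push_cast [hD]
        linear_combination -h
      have hsq : ((t' : ℤ) - t) ^ 2 < (L : ℤ) ^ 2 := by
        apply sq_lt_sq' <;> omega
      have hDabs : |D| < p := by
        rw [abs_lt]
        constructor <;> nlinarith [sq_nonneg ((t' : ℤ) - t)]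
      have hD0 : D = 0 := Int.eq_zero_of_abs_lt_dvd hDp hDabs
      have haa : a = a' + ((t' : ℤ) - t).natAbs ^ 2 := by
        have h1 : ((((t' : ℤ) - t).natAbs ^ 2 : ℕ) : ℤ) = ((t' : ℤ) - t) ^ 2 := by
          push_cast; exact sq_abs _
        omega
      have haa' : a = a' := hA a ha a' ha' _ haa
      subst haa'
      have htt : ((t' : ℤ) - t) ^ 2 = 0 := by omega
      have : (t' : ℤ) = t := by
        have := pow_eq_zero_iff (two_ne_zero) |>.mp htt
        linarith
      exact ⟨by exact_mod_cast this.symm, rfl⟩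
    · rintro ⟨rfl, rfl⟩
      ring
  refine ⟨(range L ×ˢ A).image flag, ?_, ?_⟩
  · rw [card_image_of_injOn, card_product, card_range]
    rintro ⟨t, a⟩ hta ⟨t', a'⟩ hta' h
    simp only [coe_product, Set.mem_prod, mem_coe, mem_range] at hta hta'
    have h1 : (flag (t, a)).1 ⬝ᵥ (flag (t', a')).2 = 1 := by
      rw [h]
      exact (key t' a' t' a' hta'.1 hta'.2 hta'.1 hta'.2).mpr ⟨rfl, rfl⟩
    obtain ⟨rfl, rfl⟩ := (key t a t' a' hta.1 hta.2 hta'.1 hta'.2).mp h1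
    rfl
  · intro f hf f' hf'
    simp only [mem_image] at hf hf'
    obtain ⟨⟨t, a⟩, hta, rfl⟩ := hf
    obtain ⟨⟨t', a'⟩, hta', rfl⟩ := hf'
    simp only [mem_product, mem_range] at hta hta'
    rw [key t a t' a' hta.1 hta.2 hta'.1 hta'.2]
    constructor
    · rintro ⟨rfl, rfl⟩; rfl
    · intro h
      have h1 : (flag (t, a)).1 ⬝ᵥ (flag (t', a')).2 = 1 := by
        rw [h]
        exact (key t' a' t' a' hta'.1 hta'.2 hta'.1 hta'.2).mpr ⟨rfl, rfl⟩
      exact (key t a t' a' hta.1 hta.2 hta'.1 hta'.2).mp h1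

end Lift

section Digits

/-- **Ruzsa's digit step.**  Let `m` be squarefree and `R ⊆ [0, m)` a set of residues no two of which differ by a
square modulo `m`.  If `B ⊆ [0, K)` has no two elements differing by a perfect square, then neither has
`A = {r + m·d + m²·b : r ∈ R, d < m, b ∈ B} ⊆ [0, m²K)`, and `|A| = |R|·m·|B|`.
(First differing digit: a difference `n² ≡ r − r' (mod m)` with `r ≠ r'` is excluded by `R`; if `r = r'` then
`m ∣ n²`, so `m ∣ n` as `m` is squarefree, the middle digits agree, and `b − b' = (n/m)²`.)
[cite: Ruzsa1984DifferenceSetsWithoutSquares, §2] -/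
theorem sqDiffFree_digitStep (m : ℕ) (hm : Squarefree m) (R : Finset ℕ) (hRm : ∀ r ∈ R, r < m)
    (hR : ∀ r ∈ R, ∀ r' ∈ R, ∀ x : ℕ, x < m → (x * x + r') % m = r % m → r = r')
    (B : Finset ℕ) (K : ℕ) (hBK : ∀ b ∈ B, b < K)
    (hB : ∀ a ∈ B, ∀ b ∈ B, ∀ n : ℕ, a = b + n ^ 2 → a = b) :
    ∃ A : Finset ℕ, (∀ a ∈ A, a < m * m * K) ∧ A.card = R.card * m * B.card ∧
      ∀ a ∈ A, ∀ b ∈ A, ∀ n : ℕ, a = b + n ^ 2 → a = b := by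
  classical
  have hm0 : 0 < m := Nat.pos_of_ne_zero (fun h => by subst h; exact not_squarefree_zero hm)
  -- digit decoding: `r + m * u` with `r < m` determines `r` and `u`
  have decode : ∀ r u r' u' : ℕ, r < m → r' < m → r + m * u = r' + m * u' → r = r' ∧ u = u' := by
    intro r u r' u' hr hr' h
    have h1 : (r + m * u) % m = (r' + m * u') % m := by rw [h]
    rw [Nat.add_mul_mod_self_left, Nat.add_mul_mod_self_left, Nat.mod_eq_of_lt hr,
      Nat.mod_eq_of_lt hr'] at h1
    subst h1
    refine ⟨rfl, ?_⟩
    have h2 : m * u = m * u' := by omega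
    exact Nat.eq_of_mul_eq_mul_left hm0 h2
  let enc : ℕ × ℕ × ℕ → ℕ := fun x => x.1 + m * (x.2.1 + m * x.2.2)
  refine ⟨(R ×ˢ (range m ×ˢ B)).image enc, ?_, ?_, ?_⟩
  · -- range bound
    simp only [mem_image, mem_product, mem_range]
    rintro _ ⟨⟨r, d, b⟩, ⟨hr, hd, hb⟩, rfl⟩
    have hrm := hRm r hr
    have hbK := hBK b hb
    show r + m * (d + m * b) < m * m * K
    have h1 : d + m * b + 1 ≤ m * K := by nlinarith
    nlinarith
  · -- cardinality
    rw [card_image_of_injOn, card_product, card_product, card_range, mul_assoc]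
    rintro ⟨r, d, b⟩ hx ⟨r', d', b'⟩ hx' h
    simp only [coe_product, Set.mem_prod, mem_coe, mem_range] at hx hx'
    obtain ⟨h1, h2⟩ := decode r _ r' _ (hRm r hx.1) (hRm r' hx'.1) h
    obtain ⟨h3, h4⟩ := decode d b d' b' hx.2.1 hx'.2.1 h2
    subst h1; subst h3; subst h4; rfl
  · -- no square differences
    simp only [mem_image, mem_product, mem_range]
    rintro _ ⟨⟨r, d, b⟩, ⟨hr, hd, hb⟩, rfl⟩ _ ⟨⟨r', d', b'⟩, ⟨hr', hd', hb'⟩, rfl⟩ n h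
    change r + m * (d + m * b) = r' + m * (d' + m * b') + n ^ 2 at h
    show r + m * (d + m * b) = r' + m * (d' + m * b')
    -- the lowest digit: `n² + r' ≡ r (mod m)`
    have hrr : r = r' := by
      have hrm := hRm r hr
      apply hR r hr r' hr' (n % m) (Nat.mod_lt _ hm0)
      have h1 : (r + m * (d + m * b)) % m = (r' + m * (d' + m * b') + n ^ 2) % m := by rw [h]
      have lhs : (r + m * (d + m * b)) % m = r := by
        rw [Nat.add_mul_mod_self_left, Nat.mod_eq_of_lt hrm]
      have rhs : (r' + m * (d' + m * b') + n ^ 2) % m = (n % m * (n % m) + r') % m := by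
        rw [show r' + m * (d' + m * b') + n ^ 2 = (n ^ 2 + r') + m * (d' + m * b') by ring,
          Nat.add_mul_mod_self_left, Nat.add_mod, Nat.pow_mod, ← Nat.add_mod, sq]
      rw [Nat.mod_eq_of_lt hrm, ← rhs, ← h1, lhs]
    subst hrr
    have h2 : m * (d + m * b) = m * (d' + m * b') + n ^ 2 := by omega
    -- `m ∣ n²`, hence `m ∣ n`
    have hmn2 : m ∣ n ^ 2 := ⟨d + m * b - (d' + m * b'), by rw [Nat.mul_sub]; omega⟩
    obtain ⟨n₁, rfl⟩ := hm.isRadical 2 n hmn2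
    have h3 : d + m * b = d' + m * (b' + n₁ ^ 2) := by
      have : m * (d + m * b) = m * (d' + m * (b' + n₁ ^ 2)) := by rw [h2]; ring
      exact Nat.eq_of_mul_eq_mul_left hm0 this
    obtain ⟨h4, h5⟩ := decode d b d' (b' + n₁ ^ 2) hd hd' h3
    have hbb : b = b' := hB b hb b' hb' n₁ h5
    subst h4; subst hbb
    have : n₁ = 0 := by
      have : n₁ ^ 2 = 0 := by omega
      exact pow_eq_zero_iff two_ne_zero |>.mp this
    subst this
    simp

/-- **Ruzsa's digit construction, iterated.**  With `m`, `R` as in `sqDiffFree_digitStep`, for every `k` there is a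
set `A ⊆ [0, m^{2k})` of size `(|R|·m)^k` with no two elements differing by a perfect square.
[cite: Ruzsa1984DifferenceSetsWithoutSquares, §2] -/
theorem exists_sqDiffFree_digitsBase (m : ℕ) (hm : Squarefree m) (R : Finset ℕ) (hRm : ∀ r ∈ R, r < m)
    (hR : ∀ r ∈ R, ∀ r' ∈ R, ∀ x : ℕ, x < m → (x * x + r') % m = r % m → r = r') (k : ℕ) :
    ∃ A : Finset ℕ, (∀ a ∈ A, a < m ^ (2 * k)) ∧ A.card = (R.card * m) ^ k ∧
      ∀ a ∈ A, ∀ b ∈ A, ∀ n : ℕ, a = b + n ^ 2 → a = b := by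
  induction k with
  | zero =>
    refine ⟨{0}, by simp, by simp, ?_⟩
    simp
  | succ k ih =>
    obtain ⟨B, hBK, hBcard, hB⟩ := ih
    obtain ⟨A, hAK, hAcard, hA⟩ := sqDiffFree_digitStep m hm R hRm hR B (m ^ (2 * k)) hBK hB
    refine ⟨A, fun a ha => ?_, by rw [hAcard, hBcard]; ring, hA⟩
    have := hAK a ha
    calc a < m * m * m ^ (2 * k) := this
      _ = m ^ (2 * (k + 1)) := by ring

end Digits

section Assembly

/-- **Lewko's base-205 digit set.**  The 12 residues `{0, 2, 8, 14, 77, 79, 85, 96, 103, 109, 111, 181}` modulo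
`205 = 5·41` have no two distinct members differing by a square modulo `205` (a maximum such set, found by exhaustive
search; `12 = |R|` is the parameter behind the exponent `½(1 + log 12 / log 205) = 0.7334` of Lewko 2015 /
HPVZ Lemma 2.2).  Checked by the kernel (`decide`). [elementary] -/
theorem sqDiffFree_residues_205 :
    ∀ r ∈ ({0, 2, 8, 14, 77, 79, 85, 96, 103, 109, 111, 181} : Finset ℕ),
    ∀ r' ∈ ({0, 2, 8, 14, 77, 79, 85, 96, 103, 109, 111, 181} : Finset ℕ),
    ∀ x : ℕ, x < 205 → (x * x + r') % 205 = r % 205 → r = r' := by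
  decide +kernel

/-- **Square-difference-free sets of size `N^{0.7334}`.**  For every `k` there is `A ⊆ [0, 205^{2k})` with
`|A| = 2460^k = (205^{2k})^{0.73341…}` and no two elements differing by a perfect square (Ruzsa's digits in base
`205` with Lewko's residue set). [cite: Ruzsa1984DifferenceSetsWithoutSquares, §2] -/
theorem exists_sqDiffFree_card_pow (k : ℕ) :
    ∃ A : Finset ℕ, (∀ a ∈ A, a < 205 ^ (2 * k)) ∧ A.card = 2460 ^ k ∧
      ∀ a ∈ A, ∀ b ∈ A, ∀ n : ℕ, a = b + n ^ 2 → a = b := by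
  have hsq : Squarefree (205 : ℕ) := by
    rw [show (205 : ℕ) = 5 * 41 by norm_num, Nat.squarefree_mul (by norm_num)]
    exact ⟨(Nat.prime_iff.mp (by norm_num)).squarefree, (Nat.prime_iff.mp (by norm_num)).squarefree⟩
  have hRm : ∀ r ∈ ({0, 2, 8, 14, 77, 79, 85, 96, 103, 109, 111, 181} : Finset ℕ), r < 205 := by
    intro r hr
    simp only [mem_insert, mem_singleton] at hr
    omega
  have hcard : ({0, 2, 8, 14, 77, 79, 85, 96, 103, 109, 111, 181} : Finset ℕ).card = 12 := by decide
  obtain ⟨A, h1, h2, h3⟩ := exists_sqDiffFree_digitsBase 205 hsq _ hRm sqDiffFree_residues_205 k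
  refine ⟨A, h1, ?_, h3⟩
  rw [h2, hcard]

/-- The numerical heart of the exponent: `42025^{11/15} ≤ 2460` (i.e. `205^{22} ≤ 2460^{15}`), so that
`2460^k ≥ (205^{2k})^{11/15}`: the digit sets have size `≥ N^{11/15}`, `11/15 = 0.7333… < 0.73341`. [elementary] -/
theorem rpow_42025_le : (42025 : ℝ) ^ (11 / 15 : ℝ) ≤ 2460 := by
  have key : (42025 : ℝ) ^ (11 : ℕ) ≤ (2460 : ℝ) ^ (15 : ℕ) := by norm_num
  have e1 : (42025 : ℝ) ^ (11 / 15 : ℝ) = ((42025 : ℝ) ^ (11 : ℕ)) ^ ((1 : ℝ) / 15) := by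
    rw [← Real.rpow_natCast, ← Real.rpow_mul (by norm_num)]
    norm_num
  have e2 : (2460 : ℝ) = ((2460 : ℝ) ^ (15 : ℕ)) ^ ((1 : ℝ) / 15) := by
    rw [← Real.rpow_natCast, ← Real.rpow_mul (by norm_num)]
    norm_num
  rw [e1, e2]
  exact Real.rpow_le_rpow (by positivity) key (by norm_num)

/-- **Strong representative systems of size `p^{37/30} = p^{1.2333…}` for every prime (HPVZ 2026, Thm 1.2 —
`IM(2,p) ≫ p^{1.2334}` — formalised at exponent `37/30`).**  For every prime `p` there is a strong representative
system of `AG(2,p)` — flags `(x, y)` with the line of `y` being `{v : v ⬝ᵥ y = 1}` and `x_i ⬝ᵥ y_j = 1 ↔ i = j` —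
with at least `c·p^{37/30}` flags, `c > 0` absolute.  Construction: the integer parabola lift `srs_of_sqDiffFree` with `L = ⌊√(p/2)⌋`, `N = 205^{2k} ≤ p/2`,
of the base-205 digit set `exists_sqDiffFree_card_pow`.  This is the unconditional reach of the parabola-lift axis;
the stub `stub_tangencySets` asks for exponent `3/2`, which no square-difference-free set can give (Sárközy).
[cite: HunterPohoataVerstraeteZhang2026, Thm. 1.2] -/
theorem exists_srs_card_ge_rpow :
    ∃ c : ℝ, 0 < c ∧ ∀ p : ℕ, p.Prime →
      ∃ S : Finset ((Fin 2 → ZMod p) × (Fin 2 → ZMod p)),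
        c * (p : ℝ) ^ (37 / 30 : ℝ) ≤ S.card ∧
        ∀ f ∈ S, ∀ f' ∈ S, (dotProduct f.1 f'.2 = 1 ↔ f = f') := by
  refine ⟨1 / (3 * (84050 : ℝ) ^ (11 / 15 : ℝ)), by positivity, ?_⟩
  intro p hp
  haveI : Fact p.Prime := ⟨hp⟩
  -- parameters: `k` digits pairs, `L = ⌊√(p/2)⌋`
  set k := Nat.log 42025 (p / 2) with hk
  set L := Nat.sqrt (p / 2) with hL
  have hp2 : 2 ≤ p := hp.two_le
  have hK : 42025 ^ k ≤ p / 2 := Nat.pow_log_le_self 42025 (by omega)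
  have hK' : p / 2 < 42025 ^ (k + 1) := Nat.lt_pow_succ_log_self (by norm_num) _
  have hL2 : L ^ 2 ≤ p / 2 := Nat.sqrt_le' _
  have hL2' : p / 2 < (L + 1) ^ 2 := Nat.lt_succ_sqrt' _
  obtain ⟨A, hAK, hAcard, hA⟩ := exists_sqDiffFree_card_pow k
  have h205 : 205 ^ (2 * k) = 42025 ^ k := by rw [pow_mul]; norm_num
  have hLN : L ^ 2 + 205 ^ (2 * k) ≤ p := by omega
  obtain ⟨F, hFcard, hF⟩ := srs_of_sqDiffFree L (205 ^ (2 * k)) hLN A hAK hA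
  refine ⟨F, ?_, hF⟩
  -- `√p ≤ 3 L`
  have hL1 : 1 ≤ L := by rw [hL, Nat.le_sqrt]; omega
  have hdiv2 : p ≤ 2 * (p / 2) + 1 := by omega
  have h4 : (L + 1) ^ 2 ≤ 4 * L ^ 2 := by nlinarith
  have h8L : p ≤ 8 * L ^ 2 := by omega
  have hLreal : Real.sqrt p ≤ 3 * L := by
    have h : (p : ℝ) ≤ (3 * L : ℝ) ^ 2 := by
      have : (p : ℝ) ≤ 8 * (L : ℝ) ^ 2 := by exact_mod_cast h8L
      nlinarith
    calc Real.sqrt p ≤ Real.sqrt ((3 * L : ℝ) ^ 2) := Real.sqrt_le_sqrt h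
      _ = 3 * L := Real.sqrt_sq (by positivity)
  -- `(p / 84050)^{0.733} ≤ 2460^k = |A|`
  have hpK : (p : ℝ) ≤ 84050 * (42025 : ℝ) ^ k := by
    have h : p ≤ 84050 * 42025 ^ k := by
      have h1 : p / 2 + 1 ≤ 42025 ^ (k + 1) := hK'
      rw [pow_succ] at h1
      omega
    exact_mod_cast h
  have hAreal : ((p : ℝ) / 84050) ^ (11 / 15 : ℝ) ≤ (2460 : ℝ) ^ k := by
    calc ((p : ℝ) / 84050) ^ (11 / 15 : ℝ) ≤ ((42025 : ℝ) ^ k) ^ (11 / 15 : ℝ) := by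
          apply Real.rpow_le_rpow (by positivity) _ (by norm_num)
          rw [div_le_iff₀ (by norm_num)]
          linarith
      _ = ((42025 : ℝ) ^ (11 / 15 : ℝ)) ^ k := by
          rw [← Real.rpow_natCast, ← Real.rpow_mul (by norm_num), mul_comm,
            Real.rpow_mul (by norm_num), Real.rpow_natCast]
      _ ≤ (2460 : ℝ) ^ k := pow_le_pow_left₀ (by positivity) rpow_42025_le k
  -- combine
  have hp0 : (0 : ℝ) < p := by exact_mod_cast (by omega : 0 < p)
  have hsplit : (p : ℝ) ^ (37 / 30 : ℝ) = Real.sqrt p * (p : ℝ) ^ (11 / 15 : ℝ) := by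
    rw [Real.sqrt_eq_rpow, ← Real.rpow_add hp0]
    norm_num
  have hdivp : ((p : ℝ) / 84050) ^ (11 / 15 : ℝ)
      = (p : ℝ) ^ (11 / 15 : ℝ) / (84050 : ℝ) ^ (11 / 15 : ℝ) :=
    Real.div_rpow (by positivity) (by norm_num) _
  have hFreal : (F.card : ℝ) = L * (2460 : ℝ) ^ k := by
    rw [hFcard, hAcard]
    push_cast
    ring
  have hc0 : (0 : ℝ) < (84050 : ℝ) ^ (11 / 15 : ℝ) := by positivity
  calc 1 / (3 * (84050 : ℝ) ^ (11 / 15 : ℝ)) * (p : ℝ) ^ (37 / 30 : ℝ)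
      = (Real.sqrt p / 3) * (((p : ℝ) / 84050) ^ (11 / 15 : ℝ)) := by
        rw [hsplit, hdivp]
        field_simp
    _ ≤ (L : ℝ) * (2460 : ℝ) ^ k :=
        mul_le_mul (by linarith) hAreal (by positivity) (by positivity)
    _ = F.card := hFreal.symm

/-- **The stub's format at exponent `37/30 = 1.2333…` (unconditional).**  `stub_tangencySets` with `3/2`
replaced by `37/30`: for every `p₀` there is a prime `p ≥ p₀` (in fact every prime works) carrying a strong
representative system of `AG(2,p)` of size `≥ c·p^{37/30}` (corollary of `exists_srs_card_ge_rpow` and the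
infinitude of primes). [cite: HunterPohoataVerstraeteZhang2026, Thm. 1.2] -/
theorem tangencySets_exponent_37_30 :
    ∃ c : ℝ, 0 < c ∧ ∀ p₀ : ℕ, ∃ (p : ℕ) (_ : Fact p.Prime), p₀ ≤ p ∧
      ∃ S : Finset ((Fin 2 → ZMod p) × (Fin 2 → ZMod p)),
        c * (p : ℝ) ^ (37 / 30 : ℝ) ≤ S.card ∧
        ∀ f ∈ S, ∀ f' ∈ S, (dotProduct f.1 f'.2 = 1 ↔ f = f') := by
  obtain ⟨c, hc, h⟩ := exists_srs_card_ge_rpow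
  refine ⟨c, hc, fun p₀ => ?_⟩
  obtain ⟨p, hp₀, hp⟩ := Nat.exists_infinite_primes p₀
  obtain ⟨S, hS, hsrs⟩ := h p hp
  exact ⟨p, ⟨hp⟩, hp₀, S, hS, hsrs⟩

end Assembly

end Summit.MatrixMultiplication.MatrixMultiplication.Theorems.LevelOneGL2Designs.ParabolaLift
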